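import Mathlib
import Summits.NavierStokesRegularity.OSWSelfSimilar.MirrorPlaneStrainRiccati
import HarnessLib

/-!
# The normal pressure curvature on the mirror plane in the z-LINEAR SIMILITUDE of Z8-0: free space
# (`∂_z²p|₀ ≤ 0` at every radius — the swirl OPPOSES plane collapse) versus a no-penetration wall
# (the corner COMPRESSES from rest) — the MODEL² rationale of «the corner mechanism needs the wall»

HONEST FRAMING (cell ns-blowup GROUP B, zone Z8, gate Z8-0 pen `profile/z8twin/Z8-0-PLANE-JET.md` §4 and
ERRATUM §4′ (E2)/(E3) — eng-14 g0, K-read, RULINGS (bp)/(bq); human rulings D-0035/D-0074/D-0081):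
**one-variable calculus (fundamental theorem on `[r, ∞)`, two integrations by parts on `[0, 1]`, signs of
integrals) kernel-checked on the REDUCED equations of an exact but INFINITE-ENERGY similitude class of
axisymmetric Euler (MODEL², V-MODEL); the reduced equations are HYPOTHESES; nothing here is a statement
about finite-energy Euler, about the (D)-class engine runs, or about Navier–Stokes; «violates: V-MODEL».**

THE SIMILITUDE (Z8-0 §4). Class-L ansatz `u₁ = z g(r,t)`, `ω₁ = z q`, `ψ₁ = z φ` in Hou–Li variables is
exactly invariant under axisymmetric Euler/NS; in primitive variables `u^r = U(r,t)`, `u^z = z σ(r,t)`,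
`u^θ = z r g(r,t)`, `p = p₀(r,t) + z² p₂(r,t)`, with (inviscid part written out)
  (M)  `σₜ + U σᵣ + σ² = −2 p₂`         (the `O(z)` jet of the `z`-momentum equation = CCW (4.9) on the
                                          plane, `∂_z²p|₀ = 2p₂`; `MirrorPlaneStrainRiccati`),
  (C)  `∂ᵣ p₂ = r g²`                    (the `O(z²)` part of the `r`-momentum equation: centrifugal term
                                          `(u^θ)²/r = z² r g²`),
  (D)  `∂ᵣ(rU) = −r σ`                   (incompressibility).
FREE SPACE (§1, normalisation `p₂(∞) = 0` = far field unstrained, Z8-0 §4′ (E2)): (C) integrates to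
`−∂_z²p|₀ = −2p₂(r) = B(r) := 2∫_r^∞ r′ g² dr′ ≥ 0`, non-increasing in `r`, `≤ B(0)`
(`freeSpace_normalCurvature_eq/_nonneg/_antitone`). So `∂_z²p|₀ ≤ 0` at EVERY radius: the printed
plane-collapse sign of Chae–Constantin–Wu (Thm 4.1: `∂_z²p ≥ 0` along the path) is never met at leading
order — the counter-rotating swirl layers lower the pressure OFF the plane, the plane is a pressure maximum
across itself, and the forced Riccati law (M) reads `σ̇ = −σ² + B` with `B ≥ 0` OPPOSING compression;
collapse along a plane path needs the margin `σ < −√B` (`MirrorPlaneStrainRiccati.time_lt_of_deriv_le_neg_sq_add`,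
corollary `freeSpace_collapse_needs_margin`). FROM REST (`U ≡ σ ≡ 0` at `t = 0`, (E3)):
`σₜ(r, 0) = B(r) ≥ 0` and `r Uₜ(r, 0) = −∫₀ʳ r′B ≤ 0` — the plane REPELS vertically and draws fluid INWARD
along itself: a tornado, no stagnation ring forms at `t = 0⁺` (`freeSpace_fromRest_expansion/_inflow`).
WALL (§2, the SAME similitude on `0 ≤ r ≤ 1` with no-penetration `U(1) = 0`, inviscid): now the constant in
(C) is fixed by MASS, `∫₀¹ rσ dr = 0` ⇒ `∫₀¹ r σₜ dr = 0`, and two integrations by parts give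
`p₂(1) = ∫₀¹ r³g² dr − 2∫₀¹ r σ² dr` (`wall_p2_at_corner`); the corner `(1, 0)` is a TRUE Lagrangian
stagnation point (`U(1) = 0` for all `t`), where (M) reads
`σₜ(1) = −σ(1)² − 2∫₀¹ r³g² + 4∫₀¹ rσ²` (`wall_corner_strainRate`), and FROM REST
`σₜ(1, 0) = −2∫₀¹ r³g₀² ≤ 0` (`wall_corner_fromRest_compression`; `< 0` for a non-trivial swirl jet): the
corner COMPRESSES at once — the Hou–Luo sense. DICHOTOMY (`fromRest_sign_dichotomy`): in the exact
infinite-energy reduction the swirl's centrifugal pressure enters the plane-strain Riccati law with the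
collapse-favouring sign ONLY through the wall's mass constraint; in free space it enters with the opposing
sign at every radius. This is the MODEL² rationale, beside eng-5's finite-energy maximum-principle Lemma P
(RULING (bq)(1): no ring forms in class O while `ω^θ` stays one-signed), for the zone's pre-drawn stage-1
KILL hypothesis «the corner mechanism needs the wall» — a rationale, NOT a zone word (the Z8-1 word of record
is (iii) UNDECIDED, RULING (id)(1)).
WHAT IS NOT PROVED HERE: the invariance of the ansatz (Z8-0 §4, checked by hand / eng-13 / refuter-1, not
typed), existence for the reduced system, the time-differentiated mass constraint (hypothesis `hflux`), the
far-field normalisation (hypothesis `Tendsto p₂ atTop (𝓝 0)`), anything at finite energy or for NS.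
PLACEMENT: cell-own MODEL² calculus next to `HouLuoMirrorPlaneGerm` / `MirrorPlaneStrainRiccati`
(profile-eng-14 g7, Z8 engine-B seat, 0 kit). bears on LADDER-NS N5 / zone Z8 (stage-1 mechanism) → N1.
-/

noncomputable section

open Set Filter Real MeasureTheory intervalIntegral
open scoped Topology

namespace Summit.NavierStokesRegularity.OSWSelfSimilar
namespace MirrorPlaneSimilitudePressure

/-! ### §1 Free space: `−∂_z²p|₀ = 2∫_r^∞ r′g² ≥ 0` — the swirl opposes plane collapse -/

/-- **(E2) The normal pressure curvature of the free-space similitude.** If `∂ᵣp₂ = r g²` on `[r, ∞)`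
(the `O(z²)` `r`-momentum balance (C)), `r′ ↦ r′ g(r′)²` is integrable on `(r, ∞)` and `p₂ → 0` at infinity
(far field unstrained), then `−2 p₂(r) = 2∫_{(r,∞)} r′ g(r′)² dr′`, i.e. `−∂_z²p|₀(r) = B(r)`.
[new here — MODEL² (Z8-0 §4′ (E2)); FTC on `[r, ∞)`] -/
theorem freeSpace_normalCurvature_eq (p₂ g : ℝ → ℝ) {r : ℝ}
    (hderiv : ∀ x ∈ Ici r, HasDerivAt p₂ (x * g x ^ 2) x)
    (hint : IntegrableOn (fun x => x * g x ^ 2) (Ioi r))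
    (hlim : Tendsto p₂ atTop (𝓝 0)) :
    -(2 * p₂ r) = 2 * ∫ x in Ioi r, x * g x ^ 2 := by
  have h := integral_Ioi_of_hasDerivAt_of_tendsto' hderiv hint hlim
  linarith

/-- **`B(r) ≥ 0` on the plane (`r ≥ 0`).** The integrand `r′ g² ≥ 0` on `(r, ∞)`, so
`2∫_{(r,∞)} r′g² ≥ 0`: in free space `∂_z²p|₀ = −B ≤ 0` at every radius — the printed plane-collapse sign
`∂_z²p ≥ 0` (CCW Thm 4.1) fails identically at leading order. [new here — MODEL²] -/
theorem freeSpace_normalCurvature_nonneg (g : ℝ → ℝ) {r : ℝ} (hr : 0 ≤ r) :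
    0 ≤ 2 * ∫ x in Ioi r, x * g x ^ 2 := by
  have h : 0 ≤ ∫ x in Ioi r, x * g x ^ 2 :=
    setIntegral_nonneg measurableSet_Ioi fun x hx => mul_nonneg (hr.trans (le_of_lt hx)) (sq_nonneg _)
  linarith

/-- **`B` is largest at the axis.** If `∂ᵣp₂ = r g² (≥ 0)` at every `r ≥ 0` then `p₂` is non-decreasing
and `B = −2p₂` is non-increasing on `[0, ∞)`: `B(r) ≤ B(0) = 2∫₀^∞ r′g²` — the ceiling of the opposing term
in the plane Riccati law is the total swirl-jet weight. [new here — MODEL²] -/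
theorem freeSpace_normalCurvature_antitone (p₂ g : ℝ → ℝ)
    (hderiv : ∀ x ∈ Ici (0 : ℝ), HasDerivAt p₂ (x * g x ^ 2) x) :
    AntitoneOn (fun r => -(2 * p₂ r)) (Ici 0) := by
  have hmono : MonotoneOn p₂ (Ici 0) :=
    monotoneOn_of_hasDerivWithinAt_nonneg (f' := fun x => x * g x ^ 2) (convex_Ici 0)
      (fun x hx => (hderiv x hx).continuousAt.continuousWithinAt)
      (fun x hx => (hderiv x (interior_subset hx)).hasDerivWithinAt)
      (fun x hx => by
        rw [interior_Ici] at hx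
        exact mul_nonneg (le_of_lt hx) (sq_nonneg _))
  intro a ha b hb hab
  have := hmono ha hb hab
  simp only [neg_le_neg_iff]
  linarith

/-- **Collapse along a free-space plane path needs the margin `σ < −√B`.** If along a particle path on
the plane the similitude strain obeys (M) in the form `σ' = −σ² + b(t)` with the opposing term bounded,
`b ≤ B` (`B > 0`, e.g. `B = B(0)` by `freeSpace_normalCurvature_antitone`), and `σ(0) < −√B`, then the
path cannot be followed past `log((σ₀ − √B)/(σ₀ + √B))/(2√B)`: Riccati breakdown of the INFINITE-ENERGY
similitude (Stuart / Childress–Ierley–Spiegel–Young type), conditional on the margin. Whether `σ` ever gets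
below `−√B` from given data is the dynamical question, not decided here. [new here — MODEL²; corollary of
`MirrorPlaneStrainRiccati.time_lt_of_deriv_le_neg_sq_add`] -/
theorem freeSpace_collapse_needs_margin {σ σ' b : ℝ → ℝ} {T B : ℝ} (hT : 0 ≤ T) (hB : 0 < B)
    (hσ : ∀ t ∈ Icc 0 T, HasDerivAt σ (σ' t) t)
    (hM : ∀ t ∈ Icc 0 T, σ' t = -(σ t) ^ 2 + b t) (hb : ∀ t ∈ Icc 0 T, b t ≤ B)
    (h0 : σ 0 < -Real.sqrt B) :
    T < Real.log ((σ 0 - Real.sqrt B) / (σ 0 + Real.sqrt B)) / (2 * Real.sqrt B) :=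
  MirrorPlaneStrainRiccati.time_lt_of_deriv_le_neg_sq_add hT hB hσ
    (fun t ht => by rw [hM t ht]; linarith [hb t ht]) h0

/-- **(E3) From rest the free plane REPELS: `σₜ(r, 0) = B(r) ≥ 0`.** At `t = 0` with `U = σ = 0` at the
point, (M) `σₜ + Uσᵣ + σ² = −2p₂` gives `σₜ = −2p₂(r) = B(r)`, and `B(r) ≥ 0`: the vertical velocity
`u^z = zσ` starts pointing AWAY from the plane on both sides. [new here — MODEL² (Z8-0 §4′ (E3))] -/
theorem freeSpace_fromRest_expansion {σt U σr σ0 p2r B : ℝ} (hM : σt + U * σr + σ0 ^ 2 = -(2 * p2r))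
    (hU : U = 0) (hσ : σ0 = 0) (hB : -(2 * p2r) = B) (hBnn : 0 ≤ B) : σt = B ∧ 0 ≤ σt := by
  subst hU hσ
  have : σt = B := by linarith [hM]
  exact ⟨this, this ▸ hBnn⟩

/-- **(E3) … and draws fluid INWARD along itself: `Uₜ(r, 0) ≤ 0`.** Differentiating (D) in time,
`r Uₜ(r) = −∫₀ʳ r′σₜ(r′) dr′` (hypothesis `hflux`); with `σₜ ≥ 0` on `[0, r]` (previous lemma) and `r > 0`,
`Uₜ(r, 0) ≤ 0`: radial INFLOW develops at every radius — a tornado configuration; no stagnation ring is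
created at `t = 0⁺` (the finite-energy class-O version is eng-5's maximum-principle Lemma P).
[new here — MODEL² (Z8-0 §4′ (E3))] -/
theorem freeSpace_fromRest_inflow (σt : ℝ → ℝ) {r Ut : ℝ} (hr : 0 < r)
    (hflux : r * Ut = -∫ x in (0 : ℝ)..r, x * σt x) (hσt : ∀ x ∈ Icc 0 r, 0 ≤ σt x) : Ut ≤ 0 := by
  have hI : 0 ≤ ∫ x in (0 : ℝ)..r, x * σt x :=
    intervalIntegral.integral_nonneg hr.le fun x hx => mul_nonneg hx.1 (hσt x hx)
  have h1 : r * Ut ≤ 0 := by linarith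
  nlinarith

/-! ### §2 Wall at `r = 1`: the mass constraint flips the sign at the corner -/

/-- **The wall value of `p₂`.** In the similitude on `0 ≤ r ≤ 1` with no-penetration (`U(1) = 0`): from
(D) `∂ᵣ(rU) = −rσ`, (M) `σₜ + Uσᵣ + σ² = −2p₂`, (C) `∂ᵣp₂ = r g²` on `[0, 1]` and the time-differentiated
mass constraint `∫₀¹ r σₜ dr = 0` (from `∫₀¹ rσ dr = −[rU]₀¹ = 0`), two integrations by parts
(`∫₀¹ (rU)σᵣ = ∫₀¹ rσ²` using `U(1) = 0`; `∫₀¹ r p₂ = p₂(1)/2 − ½∫₀¹ r³g²`) give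
`p₂(1) = ∫₀¹ r³ g² dr − 2∫₀¹ r σ² dr`. [new here — MODEL²] -/
theorem wall_p2_at_corner (U σ σt σr p₂ g : ℝ → ℝ) (hU1 : U 1 = 0)
    (hD : ∀ x ∈ uIcc (0 : ℝ) 1, HasDerivAt (fun y => y * U y) (-(x * σ x)) x)
    (hσ : ∀ x ∈ uIcc (0 : ℝ) 1, HasDerivAt σ (σr x) x)
    (hC : ∀ x ∈ uIcc (0 : ℝ) 1, HasDerivAt p₂ (x * g x ^ 2) x)
    (hM : ∀ x ∈ uIcc (0 : ℝ) 1, σt x + U x * σr x + σ x ^ 2 = -(2 * p₂ x))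
    (hflux : ∫ x in (0 : ℝ)..1, x * σt x = 0)
    (hσt : IntervalIntegrable σt volume 0 1) (hσr : IntervalIntegrable σr volume 0 1)
    (hσc : Continuous σ) (hg : Continuous g) :
    p₂ 1 = (∫ x in (0 : ℝ)..1, x ^ 3 * g x ^ 2) - 2 * ∫ x in (0 : ℝ)..1, x * σ x ^ 2 := by
  -- continuity / integrability bookkeeping
  have hUc : ContinuousOn (fun y => y * U y) (uIcc (0 : ℝ) 1) :=
    fun x hx => (hD x hx).continuousAt.continuousWithinAt
  have hxσ : Continuous fun x => x * σ x := continuous_id.mul hσc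
  have hxσ2 : Continuous fun x => x * σ x ^ 2 := continuous_id.mul (hσc.pow 2)
  have hxg : Continuous fun x => x * g x ^ 2 := continuous_id.mul (hg.pow 2)
  have hx3g : Continuous fun x => x ^ 3 * g x ^ 2 := (continuous_id.pow 3).mul (hg.pow 2)
  -- (A) ∫ (rU) σᵣ = ∫ r σ²
  have hA : ∫ x in (0 : ℝ)..1, (x * U x) * σr x = ∫ x in (0 : ℝ)..1, x * σ x ^ 2 := by
    have h := integral_mul_deriv_eq_deriv_mul hD hσ (hxσ.neg.intervalIntegrable 0 1) hσr
    rw [h, hU1]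
    have e : (fun x => -(x * σ x) * σ x) = fun x => -(x * σ x ^ 2) := funext fun x => by ring
    simp only [e, intervalIntegral.integral_neg, mul_zero, zero_mul, sub_zero]
    ring
  -- (B) ∫ r(−2p₂) = 2 ∫ r σ²
  have hB : ∫ x in (0 : ℝ)..1, x * (-(2 * p₂ x)) = 2 * ∫ x in (0 : ℝ)..1, x * σ x ^ 2 := by
    have e : EqOn (fun x => x * (-(2 * p₂ x))) (fun x => x * σt x + (x * U x) * σr x + x * σ x ^ 2)
        (uIcc (0 : ℝ) 1) := fun x hx => by
      simp only
      rw [← hM x hx]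
      ring
    rw [integral_congr e]
    have i1 : IntervalIntegrable (fun x => x * σt x) volume 0 1 :=
      hσt.continuousOn_mul continuousOn_id
    have i2 : IntervalIntegrable (fun x => (x * U x) * σr x) volume 0 1 := hσr.continuousOn_mul hUc
    have i3 : IntervalIntegrable (fun x => x * σ x ^ 2) volume 0 1 := hxσ2.intervalIntegrable 0 1
    rw [integral_add (i1.add i2) i3, integral_add i1 i2, hflux, hA]
    ring
  -- (B') ∫ r(−2p₂) = −2 ∫ r p₂
  have hB' : ∫ x in (0 : ℝ)..1, x * (-(2 * p₂ x)) = -2 * ∫ x in (0 : ℝ)..1, p₂ x * x := by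
    rw [← intervalIntegral.integral_const_mul]
    exact integral_congr fun x _ => by ring
  -- (C') ∫ p₂ r = p₂(1)/2 − ½ ∫ r³ g²
  have hC' : ∫ x in (0 : ℝ)..1, p₂ x * x
      = p₂ 1 * (1 / 2) - (1 / 2) * ∫ x in (0 : ℝ)..1, x ^ 3 * g x ^ 2 := by
    have hv : ∀ x ∈ uIcc (0 : ℝ) 1, HasDerivAt (fun y : ℝ => y ^ 2 / 2) x x := by
      intro x _
      have := (hasDerivAt_pow 2 x).div_const 2
      simpa using this.congr_deriv (by ring)
    have h := integral_mul_deriv_eq_deriv_mul hC hv (hxg.intervalIntegrable 0 1)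
      (continuous_id.intervalIntegrable 0 1)
    rw [h]
    have e : (fun x => x * g x ^ 2 * (x ^ 2 / 2)) = fun x => (1 / 2) * (x ^ 3 * g x ^ 2) :=
      funext fun x => by ring
    rw [e, intervalIntegral.integral_const_mul]
    ring
  -- combine
  have := hB.symm.trans hB'
  rw [hC'] at this
  linarith

/-- **The corner strain law.** At the corner `(r, z) = (1, 0)` the no-penetration condition makes the
point Lagrangian (`U(1) = 0`), so (M) reads `σₜ(1) = −σ(1)² − 2p₂(1)`; with `wall_p2_at_corner`:
`σₜ(1) = −σ(1)² − 2∫₀¹ r³g² + 4∫₀¹ rσ²`. [new here — MODEL²] -/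
theorem wall_corner_strainRate {σt1 U1 σr1 σ1 p21 I3 I1 : ℝ}
    (hM : σt1 + U1 * σr1 + σ1 ^ 2 = -(2 * p21)) (hU1 : U1 = 0) (hp : p21 = I3 - 2 * I1) :
    σt1 = -σ1 ^ 2 - 2 * I3 + 4 * I1 := by
  subst hU1
  rw [hp] at hM
  linarith

/-- **From rest the CORNER COMPRESSES: `σₜ(1, 0) = −2∫₀¹ r³g₀² ≤ 0`.** With `σ ≡ 0` at `t = 0`
(`σ(1) = 0`, `∫₀¹ rσ² = 0`) the corner law gives `σₜ(1, 0) = −2∫₀¹ r³ g₀²`, which is `≤ 0`, and `< 0` as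
soon as the swirl jet is non-trivial (`∫₀¹ r³g₀² > 0`): fluid on the wall is pushed toward the plane — the
Hou–Luo corner sense, present from `t = 0⁺`. [new here — MODEL²] -/
theorem wall_corner_fromRest_compression (g : ℝ → ℝ) {σt1 U1 σr1 σ1 p21 I1 : ℝ}
    (hM : σt1 + U1 * σr1 + σ1 ^ 2 = -(2 * p21)) (hU1 : U1 = 0)
    (hp : p21 = (∫ x in (0 : ℝ)..1, x ^ 3 * g x ^ 2) - 2 * I1) (hσ1 : σ1 = 0) (hI1 : I1 = 0) :
    σt1 = -2 * ∫ x in (0 : ℝ)..1, x ^ 3 * g x ^ 2 ∧ σt1 ≤ 0 ∧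
      (0 < ∫ x in (0 : ℝ)..1, x ^ 3 * g x ^ 2 → σt1 < 0) := by
  have h := wall_corner_strainRate hM hU1 hp
  rw [hσ1, hI1] at h
  have hI : 0 ≤ ∫ x in (0 : ℝ)..1, x ^ 3 * g x ^ 2 :=
    intervalIntegral.integral_nonneg zero_le_one fun x hx => mul_nonneg (pow_nonneg hx.1 3) (sq_nonneg _)
  refine ⟨by linarith, by linarith, fun hpos => by linarith⟩

/-- **THE SIGN DICHOTOMY FROM REST (free plane vs wall corner).** For the same swirl-jet profile `g₀`:
in free space the plane-normal strain rate at `t = 0` is `σₜ(r, 0) = 2∫_{(r,∞)} r′g₀² ≥ 0` at every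
radius `r ≥ 0` (the plane repels), while at a no-penetration wall the corner value is
`σₜ(1, 0) = −2∫₀¹ r³g₀² ≤ 0` (the corner compresses). In the exact infinite-energy reduction the swirl's
centrifugal pressure enters the plane-strain Riccati law with the collapse-favouring sign only through the
wall's mass constraint. [new here — MODEL² dichotomy; rationale (not a word) for Z8 stage-1 «the corner
mechanism needs the wall»] -/
theorem fromRest_sign_dichotomy (g : ℝ → ℝ) {r σt_free σt_wall : ℝ} (hr : 0 ≤ r)
    (hfree : σt_free = 2 * ∫ x in Ioi r, x * g x ^ 2)
    (hwall : σt_wall = -2 * ∫ x in (0 : ℝ)..1, x ^ 3 * g x ^ 2) :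
    0 ≤ σt_free ∧ σt_wall ≤ 0 := by
  refine ⟨hfree ▸ freeSpace_normalCurvature_nonneg g hr, ?_⟩
  have hI : 0 ≤ ∫ x in (0 : ℝ)..1, x ^ 3 * g x ^ 2 :=
    intervalIntegral.integral_nonneg zero_le_one fun x hx => mul_nonneg (pow_nonneg hx.1 3) (sq_nonneg _)
  rw [hwall]
  linarith

end MirrorPlaneSimilitudePressure
end Summit.NavierStokesRegularity.OSWSelfSimilar
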